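import Mathlib.Analysis.SpecificLimits.Basic
import Mathlib.Algebra.Order.Floor.Defs
import Mathlib.Algebra.BigOperators.Intervals
import Mathlib.Algebra.BigOperators.Field
import HarnessLib

/-!
# C177 `Wu2026` — SALVAGE, TRUE column: Lemma 3.1 (dyadic good-scale selection) PROVED
# (D-0090 NS-CLAIMS, LADDER row rung 3; salvage seat `ns-claims-salvage-p3`)

Kernel proof of the elementary selection lemma of the printed spine of arXiv:2608.22471v1
(«Theorem 3.1» in the text's cross-references = Lemma 3.1 p.8 l.54–58, proof p.8 l.59 – p.9 l.45):

«**Lemma 3.1 (Dyadic good-scale selection).** If a nonnegative sequence satisfies (3.8)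
[`Σ_{k=0}^{N} a_k ≤ C₀(N + 1)`, `N ≥ 0`], then there are integers `n_j → ∞`, indexed by `j ≥ 1`, and
finite constants `B_m`, indexed by `m ≥ 0`, such that `a_{n_j+m} ≤ B_m` whenever `m ≥ 0` and
`j ≥ max{1, m}`. (3.9) In fact, one may take `B_m = K₀(m + 1)²`, where `K₀ = max{1, 16C₀}`.»

The proof follows the print: (i) ONE GOOD BLOCK (p.8 l.63 – p.9 l.8): for `L < N`, counting the
starting indices `n ∈ [N, 2N]` that are bad at some offset `m ≤ L` against `Σ_m 1/B_m` (here bounded by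
the telescoping `Σ_{m≤L} 1/(m+1)² ≤ 2` in place of the printed `π²/6`) leaves a good index —
`exists_good_block`; (ii) SUCCESSIVE BLOCKS (p.9 l.9–16): `n₀ = 0`, `N_j > max{j, 2n_{j−1}}`, `L = j` —
`dyadic_good_scale_selection`, with `n_j > 2n_{j−1}` (so `n_j → ∞`) and (3.9) for `j ≥ max{1,m}`.
Pure real/natural-number bookkeeping (Mathlib only); no Navier–Stokes object enters. Typed ahead of the
row's skeleton `Literature.Claims.NS.Wu2026` (typist-10 g6); the skeleton's `Step` for Lemma 3.1 is
re-keyed to this theorem by a one-line bridge when it lands.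

WHAT THIS IS NOT: not a claim about NS regularity or blow-up; not a claim about any author beyond the
typed locator.
-/

set_option linter.dupNamespace false

open Finset Filter

namespace Summit.NavierStokesRegularity.NavierStokesRegularity.Theorems.Wu2026Salvage

/-- Telescoping bound replacing the printed `Σ 1/(m+1)² = π²/6`: `Σ_{m=0}^{L} 1/(m+1)² ≤ 2 − 1/(L+1) ≤ 2`.
[cite: Wu2026, Lemma 3.1 proof (3.10) p.8 l.59–p.9 l.1 (arXiv:2608.22471v1)] -/
theorem sum_inv_sq_le (L : ℕ) :
    ∑ m ∈ range (L + 1), (1 : ℝ) / ((m : ℝ) + 1) ^ 2 ≤ 2 - 1 / ((L : ℝ) + 1) := by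
  induction L with
  | zero => norm_num
  | succ L ih =>
    rw [sum_range_succ]
    have hL : (0 : ℝ) < (L : ℝ) + 1 := by positivity
    have hL2 : (0 : ℝ) < (L : ℝ) + 1 + 1 := by positivity
    have key : 1 / (((L + 1 : ℕ) : ℝ) + 1) ^ 2 ≤ 1 / ((L : ℝ) + 1) - 1 / (((L + 1 : ℕ) : ℝ) + 1) := by
      push_cast
      rw [div_sub_div _ _ hL.ne' hL2.ne', div_le_div_iff₀ (by positivity) (by positivity)]
      nlinarith
    push_cast at key ⊢
    linarith

/-- `Σ_{m=0}^{L} 1/(m+1)² ≤ 2`. [cite: Wu2026, Lemma 3.1 proof (3.10) p.8 (arXiv:2608.22471v1)] -/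
theorem sum_inv_sq_le_two (L : ℕ) : ∑ m ∈ range (L + 1), (1 : ℝ) / ((m : ℝ) + 1) ^ 2 ≤ 2 := by
  have h := sum_inv_sq_le L
  have : (0 : ℝ) ≤ 1 / ((L : ℝ) + 1) := by positivity
  linarith

/-- **One good block** (p.8 l.63 – p.9 l.8, (3.11)–(3.15)): if `a ≥ 0` has `Σ_{k≤N} a_k ≤ C₀(N+1)` for all
`N`, then for all `L < N` some starting index `n ∈ [N, 2N]` satisfies `a_{n+m} ≤ K₀(m+1)²` for every
`m ≤ L`, `K₀ = max{1, 16C₀}` (the indices bad at offset `m` number at most `3C₀N/B_m`, and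
`3C₀N·Σ_m 1/B_m ≤ 3N/8 < N + 1`). [cite: Wu2026, Lemma 3.1 proof (3.11)–(3.15) p.8–9 (arXiv:2608.22471v1)] -/
theorem exists_good_block {a : ℕ → ℝ} (ha : ∀ k, 0 ≤ a k) {C₀ : ℝ}
    (hsum : ∀ N : ℕ, ∑ k ∈ range (N + 1), a k ≤ C₀ * ((N : ℝ) + 1)) {L N : ℕ} (hLN : L < N) :
    ∃ n : ℕ, N ≤ n ∧ n ≤ 2 * N ∧ ∀ m : ℕ, m ≤ L → a (n + m) ≤ max 1 (16 * C₀) * ((m : ℝ) + 1) ^ 2 := by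
  set K₀ : ℝ := max 1 (16 * C₀) with hK₀
  have hK₀pos : 0 < K₀ := lt_of_lt_of_le one_pos (le_max_left _ _)
  have hC₀ : 0 ≤ C₀ := by
    have h0 := hsum 0
    simp only [zero_add, range_one, sum_singleton, Nat.cast_zero, mul_one] at h0
    exact (ha 0).trans h0
  have hCK : C₀ / K₀ ≤ 1 / 16 := by
    rw [div_le_div_iff₀ hK₀pos (by norm_num : (0 : ℝ) < 16)]
    have : 16 * C₀ ≤ K₀ := le_max_right _ _
    linarith
  -- `B m = K₀ (m+1)²`
  set B : ℕ → ℝ := fun m => K₀ * ((m : ℝ) + 1) ^ 2 with hB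
  have hBpos : ∀ m, 0 < B m := fun m => by rw [hB]; positivity
  by_contra hbad
  push Not at hbad
  -- every starting index `N + i`, `i ≤ N`, is bad at some offset `m ≤ L`
  have hbad' : ∀ i ∈ range (N + 1), ∃ m ∈ range (L + 1), B m < a (N + i + m) := by
    intro i hi
    have hi' : i ≤ N := Nat.lt_succ_iff.1 (mem_range.1 hi)
    obtain ⟨m, hmL, hm⟩ := hbad (N + i) (Nat.le_add_right _ _) (by omega)
    exact ⟨m, mem_range.2 (Nat.lt_succ_of_le hmL), by rw [hB]; exact hm⟩
  -- the double sum `S = Σ_i Σ_m a(N+i+m)/B m`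
  set S : ℝ := ∑ i ∈ range (N + 1), ∑ m ∈ range (L + 1), a (N + i + m) / B m with hS
  -- lower bound: each inner sum is ≥ 1
  have hlow : ((N : ℝ) + 1) ≤ S := by
    have h1 : ∀ i ∈ range (N + 1), (1 : ℝ) ≤ ∑ m ∈ range (L + 1), a (N + i + m) / B m := by
      intro i hi
      obtain ⟨m, hm, hlt⟩ := hbad' i hi
      have hterm : 1 ≤ a (N + i + m) / B m := by
        rw [le_div_iff₀ (hBpos m)]
        linarith
      exact hterm.trans
        (single_le_sum (f := fun m => a (N + i + m) / B m)
          (fun m _ => div_nonneg (ha _) (hBpos m).le) hm)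
    calc ((N : ℝ) + 1) = ∑ _i ∈ range (N + 1), (1 : ℝ) := by simp
      _ ≤ S := sum_le_sum h1
  -- upper bound: swap the sums and bound each inner sum by `Σ_{r ≤ 2N+L} a r ≤ 3 C₀ N`
  have hN1 : 1 ≤ N := by omega
  have hinner : ∀ m ∈ range (L + 1), ∑ i ∈ range (N + 1), a (N + i + m) ≤ 3 * C₀ * N := by
    intro m hm
    have hmL : m ≤ L := Nat.lt_succ_iff.1 (mem_range.1 hm)
    -- reindex `i ↦ N + i + m`, an injection of `range (N+1)` into `range (2N+L+1)`
    let e : ℕ ↪ ℕ := ⟨fun i => N + i + m, fun i j h => by simpa using h⟩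
    have hsub : (range (N + 1)).map e ⊆ range (2 * N + L + 1) := by
      intro r hr
      obtain ⟨i, hi, rfl⟩ := mem_map.1 hr
      have hi' : i ≤ N := Nat.lt_succ_iff.1 (mem_range.1 hi)
      simp only [mem_range, e, Function.Embedding.coeFn_mk]
      omega
    calc ∑ i ∈ range (N + 1), a (N + i + m) = ∑ r ∈ (range (N + 1)).map e, a r := by
          rw [sum_map]; rfl
      _ ≤ ∑ r ∈ range (2 * N + L + 1), a r :=
          sum_le_sum_of_subset_of_nonneg hsub fun r _ _ => ha r
      _ ≤ C₀ * (((2 * N + L : ℕ) : ℝ) + 1) := hsum (2 * N + L)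
      _ ≤ 3 * C₀ * N := by
          have h3 : (((2 * N + L : ℕ) : ℝ) + 1) ≤ 3 * (N : ℝ) := by
            have : 2 * N + L + 1 ≤ 3 * N := by omega
            exact_mod_cast this
          nlinarith
  have hup : S ≤ 3 * C₀ * N * (2 / K₀) := by
    calc S = ∑ m ∈ range (L + 1), ∑ i ∈ range (N + 1), a (N + i + m) / B m := by
          rw [hS, sum_comm]
      _ = ∑ m ∈ range (L + 1), (∑ i ∈ range (N + 1), a (N + i + m)) / B m := by
          refine sum_congr rfl fun m _ => ?_
          rw [Finset.sum_div]
      _ ≤ ∑ m ∈ range (L + 1), (3 * C₀ * N) / B m := by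
          refine sum_le_sum fun m hm => ?_
          exact div_le_div_of_nonneg_right (hinner m hm) (hBpos m).le
      _ = 3 * C₀ * N * ((1 / K₀) * ∑ m ∈ range (L + 1), 1 / ((m : ℝ) + 1) ^ 2) := by
          rw [mul_sum, mul_sum]
          refine sum_congr rfl fun m _ => ?_
          rw [hB]
          field_simp
      _ ≤ 3 * C₀ * N * ((1 / K₀) * 2) := by
          have h2 := sum_inv_sq_le_two L
          have hc : 0 ≤ 3 * C₀ * (N : ℝ) := by positivity
          have hk : 0 ≤ 1 / K₀ := by positivity
          exact mul_le_mul_of_nonneg_left (mul_le_mul_of_nonneg_left h2 hk) hc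
      _ = 3 * C₀ * N * (2 / K₀) := by ring
  -- combine: `N + 1 ≤ 6 C₀ N / K₀ ≤ 3N/8`, absurd
  have hfin : 3 * C₀ * (N : ℝ) * (2 / K₀) ≤ 3 * (N : ℝ) / 8 := by
    have hN0 : (0 : ℝ) ≤ N := Nat.cast_nonneg _
    have : 3 * C₀ * (N : ℝ) * (2 / K₀) = 6 * (N : ℝ) * (C₀ / K₀) := by ring
    rw [this]
    nlinarith
  have hNR : (0 : ℝ) ≤ N := Nat.cast_nonneg _
  linarith

/-- **Lemma 3.1 (Dyadic good-scale selection), as printed** (p.8 l.54–58): for a nonnegative sequence with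
`Σ_{k=0}^{N} a_k ≤ C₀(N+1)` for all `N ≥ 0` there is `n : ℕ → ℕ` (`n₀ = 0`, `n_j > 2n_{j−1}`, hence
`n_j → ∞`) with `a_{n_j+m} ≤ K₀(m+1)²`, `K₀ = max{1, 16C₀}`, whenever `j ≥ max{1, m}` — the successive
blocks of the printed proof with `N_j = max{j, 2n_{j−1}} + 1`, `L = j`.
[cite: Wu2026, Lemma 3.1 (3.9) p.8 l.54–58; proof p.9 l.9–16 (arXiv:2608.22471v1)] -/
theorem dyadic_good_scale_selection {a : ℕ → ℝ} (ha : ∀ k, 0 ≤ a k) {C₀ : ℝ}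
    (hsum : ∀ N : ℕ, ∑ k ∈ range (N + 1), a k ≤ C₀ * ((N : ℝ) + 1)) :
    ∃ n : ℕ → ℕ, n 0 = 0 ∧ (∀ j, 2 * n j < n (j + 1)) ∧ (∀ j, j ≤ n j) ∧ Tendsto n atTop atTop ∧
      ∀ m j : ℕ, max 1 m ≤ j → a (n j + m) ≤ max 1 (16 * C₀) * ((m : ℝ) + 1) ^ 2 := by
  -- the step map: from `(j, previous index p)` a good block start `> 2p`, `≥ j`, good for offsets `≤ j`
  have hstep : ∀ j p : ℕ, ∃ q : ℕ, 2 * p < q ∧ j ≤ q ∧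
      ∀ m : ℕ, m ≤ j → a (q + m) ≤ max 1 (16 * C₀) * ((m : ℝ) + 1) ^ 2 := by
    intro j p
    obtain ⟨q, hq1, -, hq3⟩ :=
      exists_good_block ha hsum (L := j) (N := max j (2 * p) + 1) (by omega)
    exact ⟨q, by omega, by omega, hq3⟩
  choose g hg using hstep
  -- the chain `n 0 = 0`, `n (j+1) = g (j+1) (n j)`
  let n : ℕ → ℕ := fun j => Nat.rec 0 (fun j' prev => g (j' + 1) prev) j
  have hn0 : n 0 = 0 := rfl
  have hnsucc : ∀ j, n (j + 1) = g (j + 1) (n j) := fun j => rfl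
  have hgrow : ∀ j, 2 * n j < n (j + 1) := fun j => by rw [hnsucc]; exact (hg (j + 1) (n j)).1
  have hge : ∀ j, j ≤ n j := by
    intro j
    cases j with
    | zero => simp [hn0]
    | succ j => rw [hnsucc]; exact (hg (j + 1) (n j)).2.1
  refine ⟨n, hn0, hgrow, hge, tendsto_atTop_mono hge tendsto_id, ?_⟩
  intro m j hj
  obtain ⟨j', rfl⟩ : ∃ j', j = j' + 1 := ⟨j - 1, by omega⟩
  rw [hnsucc]
  exact (hg (j' + 1) (n j')).2.2 m (by omega)

end Summit.NavierStokesRegularity.NavierStokesRegularity.Theorems.Wu2026Salvage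

-- WHAT THIS IS NOT: not a claim about NS regularity or blow-up; not a claim about any author beyond the typed locator.
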